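import Literature.Probability.LatticeModels.IsingLaceFirstExpansion
import Literature.Probability.LatticeModels.IsingLaceClusterOffDecoupling
import HarnessLib

/-!
# The first pivotal bond through `𝒜`: Sakai's decomposition (2.29) of `1{v ⟷ x through 𝒜}`

Topic `Probability/LatticeModels`, grouping namespace `IsingLace`. First file of the proof of the
second-expansion identity (2.35) of A. Sakai, *Lace expansion for the Ising model* (the tree's named
fact `IsingLace.Sakai2007_secondExpansion` of `IsingLaceNesting.lean`). The second stage of the
expansion (§2.2.2) starts from Proposition 2.2 (the tree's `twoPoint_sub_twoPointOff_eq_tsum`) and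
decomposes the indicator `1{v ⟷_N x through 𝒜}` "depending on whether or not there is a pivotal
bond `b` for `v ⟷_N x` from `v` such that `v ⟷_N b̲ through 𝒜`"; on the complement of the event
`E_N(v, x; 𝒜)` ((2.28), the tree's `IsingLace.laceEvent`) "we take the first pivotal bond `b` for
`v ⟷ x` from `v` satisfying `v ⟷ b̲ through 𝒜`. Then we have (cf. (2.9))

  `1{v ⟷_N x through 𝒜} = 1{E_N(v,x;𝒜)} + Σ_b 1{E_N(v,b̲;𝒜) off b} 1{n_b > 0} 1{b̄ ⟷_N x in 𝒞^b_N(v)ᶜ}`"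

((2.29)). This file proves (2.29) for every current `N` on a finite graph, as an identity of real
indicators (`indicator_connThrough_eq`), the qualifying directed bonds being
`IsFirstThrough G N 𝒜 v x d` (the three indicators, with "`E_N(v,b̲;𝒜)` off `b`" read as the event
evaluated at `n_b = 0` — the same reading as the tree's `IsFirstPivotal` for (2.9); given the third
indicator the event does not depend on `n_b`): a qualifying bond forces `v ⟷ x through 𝒜` and
excludes `E_N(v,x;𝒜)` (`IsFirstThrough.connThrough`, `IsFirstThrough.not_laceEvent`), it is unique
(`IsFirstThrough.unique`, by the linear order of the separating edges of the trace graph,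
`Literature/Combinatorics/SimpleGraph/SeparatingBridges.lean`), and it exists on
`{v ⟷ x through 𝒜} ∖ E_N(v,x;𝒜)` (`exists_isFirstThrough`: the pivotal bond through `𝒜` with the
smallest cluster `𝒞^b_N(v)`). The graph-theoretic input is the behaviour of paths at a one-edge cut
(`cut_notMem_edges_of_isPath`, `cut_exists_prefix`).

## References

* A. Sakai, *Lace expansion for the Ising model*, Comm. Math. Phys. 272 (2007) 283–344,
  arXiv:math-ph/0510093: Definition 2.1, (2.28)–(2.29) [Sakai2007].
(Equation numbers are those of the arXiv version held in the literature store, every display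
counted.)
-/

noncomputable section

open Finset
open Literature.Combinatorics.SimpleGraph

namespace Literature.Probability.LatticeModels

variable {V : Type*} [Fintype V] [DecidableEq V] {G : SimpleGraph V} [DecidableRel G.Adj]

namespace IsingLace

/-! ## Walks at a one-edge cut -/

section Graph

variable {W : Type*} {T : SimpleGraph W}

/-- Walks from a vertex set closed under adjacency stay inside it. [folklore] -/
theorem walk_support_subset_of_closed {C : Set W} (hC : ∀ a c, a ∈ C → T.Adj a c → c ∈ C)
    {a c : W} (p : T.Walk a c) (ha : a ∈ C) : ∀ z ∈ p.support, z ∈ C := by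
  induction p with
  | nil =>
    intro z hz
    rw [SimpleGraph.Walk.support_nil, List.mem_singleton] at hz
    exact hz ▸ ha
  | @cons a b c hadj p ih =>
    intro z hz
    rw [SimpleGraph.Walk.support_cons, List.mem_cons] at hz
    rcases hz with rfl | hz
    · exact ha
    · exact ih (hC a b ha hadj) z hz

/-- **Crossing a one-edge cut**: if every edge of `T` leaving `C` is `s(u, w)`, a walk from `C` to
outside `C` uses `s(u, w)`. [folklore] -/
theorem cut_mem_edges_of_walk {C : Set W} {u w : W}
    (hcut : ∀ a c, a ∈ C → c ∉ C → T.Adj a c → s(a, c) = s(u, w))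
    {a c : W} (q : T.Walk a c) (ha : a ∈ C) (hc : c ∉ C) : s(u, w) ∈ q.edges := by
  obtain ⟨d, hd, hd1, hd2⟩ := q.exists_boundary_dart C ha hc
  have he : d.edge = s(u, w) := hcut _ _ hd1 hd2 d.adj
  rw [← he]
  exact List.mem_map.2 ⟨d, hd, rfl⟩

/-- **Paths inside a one-edge cut**: if every edge of `T` leaving `C` is `s(u, w)` with `w ∉ C`, a
path between two vertices of `C` never uses `s(u, w)` (it would use it twice). [folklore] -/
theorem cut_notMem_edges_of_isPath [DecidableEq W] {C : Set W} {u w : W}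
    (hcut : ∀ a c, a ∈ C → c ∉ C → T.Adj a c → s(a, c) = s(u, w)) (hwC : w ∉ C)
    {a c : W} {p : T.Walk a c} (hp : p.IsPath) (ha : a ∈ C) (hc : c ∈ C) :
    s(u, w) ∉ p.edges := by
  intro hb
  have hwp : w ∈ p.support := p.snd_mem_support_of_mem_edges hb
  have hspec := p.take_spec hwp
  have h1 : s(u, w) ∈ (p.takeUntil w hwp).edges := cut_mem_edges_of_walk hcut _ ha hwC
  have h2 : s(u, w) ∈ (p.dropUntil w hwp).edges := by
    have := cut_mem_edges_of_walk hcut (p.dropUntil w hwp).reverse hc hwC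
    rwa [SimpleGraph.Walk.edges_reverse, List.mem_reverse] at this
  have hnodup : p.edges.Nodup := hp.isTrail.edges_nodup
  rw [← hspec, SimpleGraph.Walk.edges_append] at hnodup
  exact (List.nodup_append.1 hnodup).2.2 _ h1 _ h2 rfl

/-- With the cut as above, a path between two vertices of `C` stays in `C`. [folklore] -/
theorem cut_support_subset_of_isPath [DecidableEq W] {C : Set W} {u w : W}
    (hcut : ∀ a c, a ∈ C → c ∉ C → T.Adj a c → s(a, c) = s(u, w)) (hwC : w ∉ C)
    {a c : W} {p : T.Walk a c} (hp : p.IsPath) (ha : a ∈ C) (hc : c ∈ C) :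
    ∀ z ∈ p.support, z ∈ C := by
  intro z hz
  by_contra hzC
  have h1 : s(u, w) ∈ (p.takeUntil z hz).edges := cut_mem_edges_of_walk hcut _ ha hzC
  exact cut_notMem_edges_of_isPath hcut hwC hp ha hc (p.edges_takeUntil_subset_edges hz h1)

/-- **The prefix before the cut**: with the cut as above (`w ∉ C`), a path from `a ∈ C` to `c ∉ C`
passes through `u`, and its part up to `u` avoids `s(u, w)` and stays in `C`. [folklore] -/
theorem cut_exists_prefix [DecidableEq W] {C : Set W} {u w : W}
    (hcut : ∀ a c, a ∈ C → c ∉ C → T.Adj a c → s(a, c) = s(u, w)) (hwC : w ∉ C)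
    {a c : W} {p : T.Walk a c} (hp : p.IsPath) (ha : a ∈ C) (hc : c ∉ C) :
    ∃ q : T.Walk a u, s(u, w) ∉ q.edges ∧ (∀ z ∈ q.support, z ∈ p.support) ∧
      ∀ z ∈ q.support, z ∈ C := by
  obtain ⟨d, hd, hd1, hd2⟩ := p.exists_boundary_dart C ha hc
  have he : d.edge = s(u, w) := hcut _ _ hd1 hd2 d.adj
  have hfst : d.fst = u := by
    have he' := he
    rw [show d.edge = s(d.fst, d.snd) from rfl, Sym2.eq_iff] at he'
    rcases he' with ⟨h1, -⟩ | ⟨h1, -⟩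
    · exact h1
    · rw [h1] at hd1
      exact absurd hd1 hwC
  have hsupp := p.dart_fst_mem_support_of_mem_darts hd
  have hpre := edge_not_mem_edges_takeUntil hp hd
  rw [he] at hpre
  refine ⟨(p.takeUntil d.fst hsupp).copy rfl hfst, ?_, ?_, ?_⟩
  · rw [SimpleGraph.Walk.edges_copy]
    exact hpre
  · intro z hz
    rw [SimpleGraph.Walk.support_copy] at hz
    exact p.support_takeUntil_subset_support hsupp hz
  · intro z hz
    rw [SimpleGraph.Walk.support_copy] at hz
    exact cut_support_subset_of_isPath hcut hwC (hp.takeUntil hsupp) ha hd1 z hz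

end Graph

/-! ## Monotonicity of the connectivity predicates, and the cut at `𝒞^b_N(v)` -/

/-- Resetting a bond decreases the current. [folklore] -/
theorem update_zero_le (N : Current G) (e : G.edgeFinset) : Function.update N e 0 ≤ N := by
  intro f
  by_cases hf : f = e
  · subst hf
    rw [Function.update_self]
    exact Nat.zero_le _
  · rw [Function.update_of_ne hf]

/-- Resetting a bond is monotone in the current. [folklore] -/
theorem update_zero_mono {N N' : Current G} (h : N ≤ N') (e : G.edgeFinset) :
    Function.update N e 0 ≤ Function.update N' e 0 := by
  intro f
  by_cases hf : f = e
  · subst hf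
    rw [Function.update_self, Function.update_self]
  · rw [Function.update_of_ne hf, Function.update_of_ne hf]
    exact h f

omit [DecidableEq V] in
/-- `x ⟷_N y` is increasing in `N`. [folklore] -/
theorem Conn.mono {N N' : Current G} (hle : N ≤ N') {x y : V} (h : Conn G N x y) : Conn G N' x y :=
  SimpleGraph.Reachable.mono (Percolation.openGraph_mono (Current.traced_mono hle)) h

omit [DecidableEq V] in
/-- `x ⟷_N y in 𝒜ᶜ` is increasing in `N`. [folklore] -/
theorem ConnAvoid.mono {N N' : Current G} (hle : N ≤ N') {A : Finset V} {x y : V}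
    (h : ConnAvoid G N A x y) : ConnAvoid G N' A x y :=
  ⟨h.1, h.2.1, Current.connIn_mono (offGraph G A) hle h.2.2⟩

/-- `𝒞^b_N(v)` does not see `n_b`. [folklore] -/
theorem clusterOff_update (N : Current G) (b : G.edgeFinset) (v : V) :
    clusterOff G (Function.update N b 0) b v = clusterOff G N b v := by
  rw [clusterOff_eq, clusterOff_eq, Function.update_idem]

/-- The cut property of `𝒞^b_N(v)`: the only trace bond leaving it is `b`. [folklore] -/
theorem clusterOff_cut (N : Current G) (d : G.Dart) (v : V) :
    ∀ a c, a ∈ (clusterOff G N (dartEdge G d) v : Set V) →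
      c ∉ (clusterOff G N (dartEdge G d) v : Set V) →
        (Percolation.openGraph N.traced).Adj a c → s(a, c) = s(d.fst, d.snd) :=
  fun _ _ ha hc hadj => edge_eq_of_adj_of_mem_clusterOff hadj (Finset.mem_coe.1 ha)
    (fun h => hc (Finset.mem_coe.2 h))

/-- **Resetting a bond with both endpoints outside does not change `𝒞^b(v)`**: if neither endpoint
of `e` lies in `𝒞^b_{N∖e}(v)`, then `𝒞^b_{N∖e}(v) = 𝒞^b_N(v)` (the smaller cluster is closed under
the bonds of `N ∖ b`). [folklore] -/
theorem clusterOff_update_eq_of_forall_notMem {N : Current G} {b e : G.edgeFinset} {v : V}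
    (h : ∀ y ∈ (e : Sym2 V), y ∉ clusterOff G (Function.update N e 0) b v) :
    clusterOff G (Function.update N e 0) b v = clusterOff G N b v := by
  by_cases hbe : e = b
  · subst hbe
    rw [clusterOff_update]
  refine Finset.Subset.antisymm (clusterOff_mono (update_zero_le N e) b v) fun z hz => ?_
  have hz' := hz
  rw [clusterOff_eq, Current.mem_cluster_iff] at hz'
  obtain ⟨p⟩ := hz'
  -- the smaller cluster is closed under adjacency in the trace of `N ∖ b`
  have hC : ∀ a c, a ∈ (clusterOff G (Function.update N e 0) b v : Set V) →
      (Percolation.openGraph (Current.traced (Function.update N b 0))).Adj a c →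
        c ∈ (clusterOff G (Function.update N e 0) b v : Set V) := by
    intro a c ha hadj
    have hne : s(a, c) ≠ (e : Sym2 V) := fun hae =>
      h a (hae ▸ Sym2.mem_mk_left a c) (Finset.mem_coe.1 ha)
    refine Finset.mem_coe.2 (mem_clusterOff_of_adj (Finset.mem_coe.1 ha) ?_)
    rw [Function.update_comm hbe, openGraph_traced_update_zero, SimpleGraph.deleteEdges_adj]
    exact ⟨hadj, fun hmem => hne (Set.mem_singleton_iff.1 hmem)⟩
  exact Finset.mem_coe.1 (walk_support_subset_of_closed hC p
    (Finset.mem_coe.2 (mem_clusterOff_self _ b v)) z p.end_mem_support)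

/-- **Avoiding connections into `𝒞^b_N(v)` do not use `b`**: if `b̄ ∉ 𝒞^b_N(v)`, `y ∈ 𝒞^b_N(v)`
and `v ⟷_N y in 𝒜ᶜ`, then already `v ⟷_{N∖b} y in 𝒜ᶜ` (a path from `v` to `y` cannot cross the
cut). [folklore] -/
theorem connAvoid_update_of_mem {N : Current G} {d : G.Dart} {v : V} {A : Finset V} {y : V}
    (hsnd : d.snd ∉ clusterOff G N (dartEdge G d) v) (hy : y ∈ clusterOff G N (dartEdge G d) v)
    (h : ConnAvoid G N A v y) : ConnAvoid G (Function.update N (dartEdge G d) 0) A v y := by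
  classical
  obtain ⟨hvA, hyA, q, hq⟩ := connAvoid_iff_exists_walk.1 h
  have hp : q.bypass.IsPath := q.bypass_isPath
  have hpq : ∀ z ∈ q.bypass.support, z ∉ A := fun z hz => hq z (q.support_bypass_subset_support hz)
  have hb := cut_notMem_edges_of_isPath (clusterOff_cut N d v) (fun h => hsnd (Finset.mem_coe.1 h))
    hp (Finset.mem_coe.2 (mem_clusterOff_self N _ v)) (Finset.mem_coe.2 hy)
  refine connAvoid_iff_exists_walk.2 ⟨hvA, hyA, ?_⟩
  rw [openGraph_traced_update_zero]
  refine ⟨q.bypass.toDeleteEdge _ hb, fun z hz => hpq z ?_⟩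
  simpa using hz

/-! ## The qualifying bonds of (2.29) -/

variable (G) in
/-- The qualifying directed bonds of the second expansion step (2.29): `E_N(v, b̲; 𝒜)` holds off
`b` (evaluated with `n_b` reset), `n_b > 0`, and `b̄ ⟷_N x in 𝒞^b_N(v)ᶜ` ("the first pivotal bond
`b` for `v ⟷ x` from `v` satisfying `v ⟷ b̲ through 𝒜`"). [cite: Sakai2007, (2.29)] -/
def IsFirstThrough (N : Current G) (A : Finset V) (v x : V) (d : G.Dart) : Prop :=
  laceEvent G (Function.update N (dartEdge G d) 0) A v d.fst ∧ 0 < N (dartEdge G d) ∧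
    ConnAvoid G N (clusterOff G N (dartEdge G d) v) d.snd x

namespace IsFirstThrough

variable {N : Current G} {A : Finset V} {v x : V} {d : G.Dart}

/-- A qualifying bond carries current: it is a bond of the trace graph. [folklore] -/
theorem traceAdj (h : IsFirstThrough G N A v x d) : (Percolation.openGraph N.traced).Adj d.fst d.snd := by
  rw [Percolation.openGraph_adj]
  exact ⟨(Current.mem_traced_iff N (dartEdge G d)).2 h.2.1, d.fst_ne_snd⟩

/-- `b̲ ∈ 𝒞^b_N(v)`. [folklore] -/
theorem fst_mem (h : IsFirstThrough G N A v x d) : d.fst ∈ clusterOff G N (dartEdge G d) v := by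
  rw [clusterOff_eq, ← conn_iff_mem_cluster]
  exact h.1.1.1

/-- `b̄ ∉ 𝒞^b_N(v)`. [folklore] -/
theorem snd_notMem (h : IsFirstThrough G N A v x d) : d.snd ∉ clusterOff G N (dartEdge G d) v :=
  (connAvoid_iff.1 h.2.2).1

/-- `x ∉ 𝒞^b_N(v)`. [folklore] -/
theorem notMem (h : IsFirstThrough G N A v x d) : x ∉ clusterOff G N (dartEdge G d) v :=
  (connAvoid_iff.1 h.2.2).2.1

/-- **A qualifying bond is pivotal for `v ⟷_N x` from `v`, with `v ⟷_N b̲` through `𝒜`.**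
[cite: Sakai2007, (2.28)–(2.29)] -/
theorem isPivotal (h : IsFirstThrough G N A v x d) : IsPivotal G N v x d ∧ ConnThrough G N A v d.fst := by
  refine ⟨⟨h.1.1.1, h.2.2⟩, ConnOff.conn (N := N) (e := dartEdge G d) h.1.1.1, fun hav => ?_⟩
  exact h.1.1.2 (connAvoid_update_of_mem h.snd_notMem h.fst_mem hav)

/-- **A qualifying bond forces `v ⟷_N x through 𝒜`** (an avoiding path from `v` to `x` would
leave `𝒞^b_N(v)` through `b`, and its part before `b̲` would avoid `𝒜` off `b`). [cite: Sakai2007, (2.29)] -/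
theorem connThrough (h : IsFirstThrough G N A v x d) : ConnThrough G N A v x := by
  classical
  obtain ⟨-, -, q₂, -⟩ := connAvoid_iff_exists_walk.1 h.2.2
  refine ⟨SimpleGraph.Reachable.trans ((ConnOff.conn (N := N) (e := dartEdge G d) h.1.1.1).trans
    h.traceAdj.reachable) ⟨q₂⟩, fun hav => ?_⟩
  obtain ⟨hvA, -, q, hq⟩ := connAvoid_iff_exists_walk.1 hav
  have hp : q.bypass.IsPath := q.bypass_isPath
  have hpq : ∀ z ∈ q.bypass.support, z ∉ A := fun z hz => hq z (q.support_bypass_subset_support hz)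
  obtain ⟨r, hr, hrp, -⟩ := cut_exists_prefix (clusterOff_cut N d v)
    (fun h' => h.snd_notMem (Finset.mem_coe.1 h')) hp
    (Finset.mem_coe.2 (mem_clusterOff_self N _ v)) (fun h' => h.notMem (Finset.mem_coe.1 h'))
  refine h.1.1.2 (connAvoid_iff_exists_walk.2 ⟨hvA, hpq _ (hrp _ r.end_mem_support), ?_⟩)
  rw [openGraph_traced_update_zero]
  refine ⟨r.toDeleteEdge _ hr, fun z hz => hpq z (hrp z ?_)⟩
  simpa using hz

/-- **A qualifying bond excludes `E_N(v, x; 𝒜)`.** [cite: Sakai2007, (2.28)–(2.29)] -/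
theorem not_laceEvent (h : IsFirstThrough G N A v x d) : ¬laceEvent G N A v x := fun hE =>
  hE.2 ⟨d, h.isPivotal⟩

/-- The edge of a qualifying bond separates `v` from `x` in the trace graph, `b̲` on the `v`-side.
[cite: Sakai2007, Definition 2.1 (iii)] -/
theorem sepEdge (h : IsFirstThrough G N A v x d) :
    SepEdge (Percolation.openGraph N.traced) v x s(d.fst, d.snd) ∧
      d.fst ∈ sepSide (Percolation.openGraph N.traced) v s(d.fst, d.snd) := by
  refine ⟨⟨(SimpleGraph.mem_edgeSet _).2 h.traceAdj, fun hr => h.notMem ?_⟩, ?_⟩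
  · exact mem_clusterOff_iff.2 hr
  · exact mem_clusterOff_iff.1 h.fst_mem

/-- **No two nested qualifying bonds**: if `𝒞^{b₁}_N(v) ⊆ 𝒞^{b₂}_N(v)` and `b̲₂ ∉ 𝒞^{b₁}_N(v)` for
two qualifying bonds, then `b₁` is pivotal for `v ⟷_{N∖b₂} b̲₂` from `v` with `v ⟷ b̲₁` through `𝒜`,
against `E_{N∖b₂}(v, b̲₂; 𝒜)`. [cite: Sakai2007, (2.29)] -/
theorem false_of_subset {d₁ d₂ : G.Dart} (h₁ : IsFirstThrough G N A v x d₁)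
    (h₂ : IsFirstThrough G N A v x d₂)
    (hsub : clusterOff G N (dartEdge G d₁) v ⊆ clusterOff G N (dartEdge G d₂) v)
    (hu₂ : d₂.fst ∉ clusterOff G N (dartEdge G d₁) v) : False := by
  classical
  set T := Percolation.openGraph N.traced with hT
  have hw₂ : d₂.snd ∉ clusterOff G N (dartEdge G d₁) v := fun h => h₂.snd_notMem (hsub h)
  -- the two edges differ
  have hne : s(d₁.fst, d₁.snd) ≠ s(d₂.fst, d₂.snd) := by
    intro he
    rcases Sym2.eq_iff.1 he with ⟨h1, -⟩ | ⟨h1, h2⟩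
    · exact hu₂ (h1 ▸ h₁.fst_mem)
    · exact h₂.snd_notMem (hsub (h1 ▸ h₁.fst_mem))
  -- resetting `b₂` does not change `𝒞^{b₁}(v)`
  have h𝒞 : clusterOff G (Function.update N (dartEdge G d₂) 0) (dartEdge G d₁) v =
      clusterOff G N (dartEdge G d₁) v := by
    refine clusterOff_update_eq_of_forall_notMem fun y hy hy' => ?_
    have hy'' := clusterOff_mono (update_zero_le N (dartEdge G d₂)) _ v hy'
    rcases Sym2.mem_iff.1 (hy : y ∈ s(d₂.fst, d₂.snd)) with rfl | rfl
    · exact hu₂ hy''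
    · exact hw₂ hy''
  -- `b̄₁ ∈ 𝒞^{b₂}(v)`
  have hw₁ : d₁.snd ∈ clusterOff G N (dartEdge G d₂) v := by
    refine mem_clusterOff_of_adj (hsub h₁.fst_mem) ?_
    rw [openGraph_traced_update_zero, SimpleGraph.deleteEdges_adj]
    exact ⟨h₁.traceAdj, fun hmem => hne (Set.mem_singleton_iff.1 hmem)⟩
  -- the walk `b̄₁ → x` off `𝒞^{b₁}(v)` leaves `𝒞^{b₂}(v)` through `b₂`; its prefix reaches `b̲₂` off `b₂`
  obtain ⟨-, -, q, hq⟩ := connAvoid_iff_exists_walk.1 h₁.2.2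
  have hp : q.bypass.IsPath := q.bypass_isPath
  obtain ⟨r, hr, hrp, -⟩ := cut_exists_prefix (clusterOff_cut N d₂ v)
    (fun h' => h₂.snd_notMem (Finset.mem_coe.1 h')) hp (Finset.mem_coe.2 hw₁)
    (fun h' => h₂.notMem (Finset.mem_coe.1 h'))
  refine h₂.1.2 ⟨d₁, ⟨?_, ?_⟩, ?_, fun hav => h₁.isPivotal.2.2 (hav.mono (update_zero_le N _))⟩
  · -- `v ⟷ b̲₁` off `b₁` in `N ∖ b₂`
    show Conn G _ v d₁.fst
    rw [conn_iff_mem_cluster, ← clusterOff_eq, h𝒞]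
    exact h₁.fst_mem
  · -- `b̄₁ ⟷ b̲₂` in `N ∖ b₂` off the cluster
    rw [h𝒞]
    refine connAvoid_iff_exists_walk.2 ⟨h₁.snd_notMem, hu₂, ?_⟩
    rw [openGraph_traced_update_zero]
    refine ⟨r.toDeleteEdge _ hr, fun z hz => hq z (q.support_bypass_subset_support (hrp z ?_))⟩
    simpa using hz
  · show Conn G _ v d₁.fst
    refine Conn.mono (update_zero_le _ (dartEdge G d₁)) ?_
    rw [conn_iff_mem_cluster, ← clusterOff_eq, h𝒞]
    exact h₁.fst_mem

/-- **Uniqueness of the qualifying bond** (the separating edges of the trace graph are linearly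
ordered). [cite: Sakai2007, (2.29)] -/
theorem unique {d₁ d₂ : G.Dart} (h₁ : IsFirstThrough G N A v x d₁) (h₂ : IsFirstThrough G N A v x d₂) :
    d₁ = d₂ := by
  classical
  by_contra hne
  set T := Percolation.openGraph N.traced with hT
  have hedge : s(d₁.fst, d₁.snd) ≠ s(d₂.fst, d₂.snd) := by
    intro he
    rcases (SimpleGraph.dart_edge_eq_iff d₁ d₂).1 he with h | h
    · exact hne h
    · have h𝒞 : clusterOff G N (dartEdge G d₁) v = clusterOff G N (dartEdge G d₂) v := by
        have : dartEdge G d₁ = dartEdge G d₂ := Subtype.ext he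
        rw [this]
      have hmem := h₁.fst_mem
      rw [h𝒞, h] at hmem
      exact h₂.snd_notMem hmem
  obtain ⟨hs₁, hf₁⟩ := h₁.sepEdge
  obtain ⟨hs₂, hf₂⟩ := h₂.sepEdge
  rcases side_ssubset_or hs₁ hs₂ h₁.connThrough.1 hedge hf₁ hf₂ with ⟨hss, hout⟩ | ⟨hss, hout⟩
  · exact h₁.false_of_subset h₂ (fun z hz => mem_clusterOff_iff.2 (hss.1 (mem_clusterOff_iff.1 hz)))
      (fun h => hout (mem_clusterOff_iff.1 h))
  · exact h₂.false_of_subset h₁ (fun z hz => mem_clusterOff_iff.2 (hss.1 (mem_clusterOff_iff.1 hz)))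
      (fun h => hout (mem_clusterOff_iff.1 h))

end IsFirstThrough

/-! ## Existence: the first pivotal bond through `𝒜` -/

section Exists

variable {N : Current G} {A : Finset V} {v x : V}

/-- **Existence of the qualifying bond** on `{v ⟷_N x through 𝒜} ∖ E_N(v, x; 𝒜)`: among the
pivotal bonds `b` for `v ⟷ x` from `v` with `v ⟷ b̲ through 𝒜`, one with the smallest cluster
`𝒞^b_N(v)` qualifies. [cite: Sakai2007, (2.29)] -/
theorem exists_isFirstThrough (hct : ConnThrough G N A v x) (hnl : ¬laceEvent G N A v x) :
    ∃ d : G.Dart, IsFirstThrough G N A v x d := by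
  classical
  have hex : ∃ d : G.Dart, IsPivotal G N v x d ∧ ConnThrough G N A v d.fst := by
    by_contra h
    exact hnl ⟨hct, h⟩
  obtain ⟨d, ⟨hpiv, hthr⟩, hmin⟩ := Set.Finite.exists_minimalFor
    (fun d : G.Dart => clusterOff G N (dartEdge G d) v)
    {d : G.Dart | IsPivotal G N v x d ∧ ConnThrough G N A v d.fst} (Set.toFinite _) hex
  have hw : d.snd ∉ clusterOff G N (dartEdge G d) v := (connAvoid_iff.1 hpiv.2).1
  have hx : x ∉ clusterOff G N (dartEdge G d) v := (connAvoid_iff.1 hpiv.2).2.1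
  have hu : d.fst ∈ clusterOff G N (dartEdge G d) v := by
    rw [clusterOff_eq, ← conn_iff_mem_cluster]
    exact hpiv.1
  -- `n_b > 0`: otherwise `𝒞^b_N(v) = C_N(v) ∋ x`
  have hpos : 0 < N (dartEdge G d) := by
    by_contra h0
    have hN : Function.update N (dartEdge G d) 0 = N :=
      Function.update_eq_self_iff.2 (Nat.eq_zero_of_not_pos h0).symm
    refine hx ?_
    rw [clusterOff_eq, hN, ← conn_iff_mem_cluster]
    exact hct.1
  refine ⟨d, ⟨⟨hpiv.1, fun hav => hthr.2 (hav.mono (update_zero_le N _))⟩, ?_⟩, hpos, hpiv.2⟩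
  -- no pivotal bond through `𝒜` precedes `b`
  rintro ⟨d', hpiv', hthr'⟩
  set S' := clusterOff G (Function.update N (dartEdge G d) 0) (dartEdge G d') v with hS'
  have hu' : d.fst ∉ S' := (connAvoid_iff.1 hpiv'.2).2.1
  have hS'𝒞 : S' ⊆ clusterOff G N (dartEdge G d) v := by
    rw [hS', clusterOff_eq, clusterOff_eq]
    exact Current.cluster_mono (update_zero_le _ (dartEdge G d')) v
  have hSe : S' = clusterOff G N (dartEdge G d') v := by
    refine clusterOff_update_eq_of_forall_notMem fun y hy hy' => ?_
    rcases Sym2.mem_iff.1 (hy : y ∈ s(d.fst, d.snd)) with rfl | rfl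
    · exact hu' hy'
    · exact hw (hS'𝒞 hy')
  have ha' : d'.fst ∈ S' := by
    rw [hS', clusterOff_eq, ← conn_iff_mem_cluster]
    exact hpiv'.1
  -- `b'` is then a candidate with a smaller cluster
  have hcand : IsPivotal G N v x d' ∧ ConnThrough G N A v d'.fst := by
    refine ⟨⟨?_, ?_⟩, (hthr'.1 : Conn G _ v d'.fst).mono (update_zero_le N _), fun hav => ?_⟩
    · exact Conn.mono (update_zero_mono (update_zero_le N (dartEdge G d)) (dartEdge G d')) hpiv'.1
    · rw [← hSe]
      obtain ⟨hc, -, q₁, hq₁⟩ := connAvoid_iff_exists_walk.1 hpiv'.2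
      obtain ⟨-, -, q₂, hq₂⟩ := connAvoid_iff_exists_walk.1 hpiv.2
      refine connAvoid_iff_exists_walk.2 ⟨hc, fun h => hx (hS'𝒞 h), ?_⟩
      have hadj : (Percolation.openGraph N.traced).Adj d.fst d.snd := by
        rw [Percolation.openGraph_adj]
        exact ⟨(Current.mem_traced_iff N (dartEdge G d)).2 hpos, d.fst_ne_snd⟩
      have hle : Percolation.openGraph (Current.traced (Function.update N (dartEdge G d) 0)) ≤
          Percolation.openGraph N.traced :=
        Percolation.openGraph_mono (Current.traced_mono (update_zero_le N _))
      refine ⟨(q₁.mapLe hle).append (SimpleGraph.Walk.cons hadj q₂), fun z hz => ?_⟩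
      rw [SimpleGraph.Walk.support_append, List.mem_append, SimpleGraph.Walk.support_mapLe_eq_support,
        SimpleGraph.Walk.support_cons, List.tail_cons] at hz
      rcases hz with hz | hz
      · exact hq₁ z hz
      · exact fun h => hq₂ z hz (hS'𝒞 h)
    · exact hthr'.2 (connAvoid_update_of_mem hw (hS'𝒞 ha') hav)
  have hle := hmin hcand (by
    change clusterOff G N (dartEdge G d') v ⊆ clusterOff G N (dartEdge G d) v
    rw [← hSe]; exact hS'𝒞)
  exact hu' (hSe ▸ hle hu)

/-- **Trichotomy**: a qualifying bond exists iff `v ⟷_N x through 𝒜` without `E_N(v, x; 𝒜)`.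
[cite: Sakai2007, (2.29)] -/
theorem exists_isFirstThrough_iff :
    (∃ d : G.Dart, IsFirstThrough G N A v x d) ↔ ConnThrough G N A v x ∧ ¬laceEvent G N A v x :=
  ⟨fun ⟨_, hd⟩ => ⟨hd.connThrough, hd.not_laceEvent⟩, fun h => exists_isFirstThrough h.1 h.2⟩

open Classical in
/-- The number of qualifying directed bonds is `1` on `{v ⟷ x through 𝒜} ∖ E_N(v,x;𝒜)` and `0`
otherwise. [cite: Sakai2007, (2.29)] -/
theorem card_filter_isFirstThrough (N : Current G) (A : Finset V) (v x : V) :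
    (univ.filter (IsFirstThrough G N A v x)).card =
      if ConnThrough G N A v x ∧ ¬laceEvent G N A v x then 1 else 0 := by
  split_ifs with h
  · obtain ⟨d₀, hd₀⟩ := exists_isFirstThrough h.1 h.2
    rw [Finset.card_eq_one]
    refine ⟨d₀, Finset.eq_singleton_iff_unique_mem.2 ⟨by simpa using hd₀, fun d hd => ?_⟩⟩
    exact IsFirstThrough.unique (by simpa using hd) hd₀
  · rw [Finset.card_eq_zero, Finset.filter_eq_empty_iff]
    intro d _ hd
    exact h (exists_isFirstThrough_iff.1 ⟨d, hd⟩)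

open Classical in
/-- **Sakai's decomposition (2.29) of `1{v ⟷_N x through 𝒜}` by the first pivotal bond through
`𝒜`**: for every current `N`,
`1{v ⟷_N x through 𝒜} = 1{E_N(v,x;𝒜)} + Σ_b 1{E_{N∖b}(v,b̲;𝒜)} 1{n_b > 0} 1{b̄ ⟷_N x in 𝒞^b_N(v)ᶜ}`.
[cite: Sakai2007, (2.29)] -/
theorem indicator_connThrough_eq (N : Current G) (A : Finset V) (v x : V) :
    (if ConnThrough G N A v x then (1 : ℝ) else 0) =
      (if laceEvent G N A v x then (1 : ℝ) else 0) +
        ∑ d : G.Dart, if IsFirstThrough G N A v x d then (1 : ℝ) else 0 := by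
  rw [Finset.sum_boole, card_filter_isFirstThrough]
  by_cases hc : ConnThrough G N A v x
  · by_cases hE : laceEvent G N A v x
    · simp [hc, hE]
    · simp [hc, hE]
  · have hE : ¬laceEvent G N A v x := fun h => hc h.1
    simp [hc, hE]

end Exists

end IsingLace

end Literature.Probability.LatticeModels

end
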